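import Summits.ValiantsHypothesis.ValiantsHypothesis.Theorems.KPlusLogSqLawTropicalBTopHeavyCoreBudget
import Summits.ValiantsHypothesis.ValiantsHypothesis.Theorems.KPlusLogSqLawTropicalBParityCensus
import Summits.ValiantsHypothesis.ValiantsHypothesis.Theorems.KPlusLogSqLawTropicalBSplitDefs

/-!
# Route «KPlusLogSqLaw», crux `TropicalB` (stmt-ValiantsHypothesis-19771) — THE CONCAVE CORE AT EVERY SIZE:
# `{c₂^m, c₁ c₃^{m−1}, c₀^{m−1} c₄}` with the `c₄`-term latest is impossible whenever `d c₃ + d c₀ ≤ 2·d c₂` — odd `m` included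

HONEST FRAMING.  Instance of this seat's budget-form transfer law (`TopHeavyCore.core_law_transfer`, …TopHeavyCoreBudget; val-sym-trop-p1 g21,
cell `pub-symmetroid`, 2026-08-28; `--supports stmt-ValiantsHypothesis-19771 --as helper`) and its census corollary.  The tree's
`ParityLaw.parity_law_concave` (val-sym-trop-p4 g12, …TropicalBParityBands) forbids the triple `c₂^m ≺ {x} + (m−1)·c₃ ≺ c₀^{m−1}·` on boards of
EVEN size under the budget `d x + (m−2)·d c₃ ≤ (m−1)·d c₂`; here, for EVERY `m ≥ 2` and either order of the first two terms, under the budget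
`d c₃ + d c₀ ≤ 2·d c₂` (neither budget implies the other).  LOCATED AS THE DIVIDING LINE: ktight finds `{2^m, 1·3^{m−1}, 0^{m−1}4}` (last term
latest) infeasible `8/8` at each of `m = 3, 4, 5` when `d₃ + d₀ ≤ 2d₂` and FEASIBLE `8/8` at each when `d₃ + d₀ > 2d₂` (tools/coreConc.py of the
deposit HOME/val-sym-trop-p1/g21/).  Structure / census statements about dominance designs; nothing here bears on `TropicalB` in its window,
`WeakLifting`, DoorA26 / DoorA34, `MatrixDescartes` (stmt-ValiantsHypothesis-18050) or VP ≠ VNP.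

* `concave_core_all` — **`d c₀ < d c₁ < d c₂ < d c₃`, `d c₀ ≤ d c₄`, `d c₃ + d c₀ ≤ 2·d c₂`, any `m ≥ 2`: no design has dominant terms `P_A`
  (`c₁` at one column, `c₃` elsewhere), `P_B = c₂^m`, `P_C` (`c₄` at one column, `c₀` elsewhere) with `P_C` the latest.**
* `concave_census_all`, `designRowD_concave_all` — census form: with the two slopes below the `c₄`-slope every chain of unique optima has
  `n + 2 ≤ multichoose K m`.  (Census-wise this region lies inside that of `core_census` when `d c₀` is minimal; the point is the forbidden triple.)
[this cell]
-/

set_option linter.dupNamespace false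
set_option autoImplicit false

namespace Summit.ValiantsHypothesis.ValiantsHypothesis.Theorems.KPlusLogSqLaw.TopHeavyCore

open Summit.ValiantsHypothesis.ValiantsHypothesis.Theorems.MatrixDescartes.Negative
open Summit.ValiantsHypothesis.ValiantsHypothesis.Theorems.LacunarySymmetroidMatrixDescartes.TropicalCensus
open Finset

variable {m K : ℕ}

/-- **THE CONCAVE CORE AT EVERY SIZE.**  `d c₀ < d c₁ < d c₂ < d c₃`, `d c₀ ≤ d c₄`, budget `d c₃ + d c₀ ≤ 2·d c₂`; any `m ≥ 2`.  No design has dominant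
terms `P_A = (σA, λA)` (`c₁` at the column `b`, `c₃` elsewhere), `P_B = (σB, λB)` (all classes `c₂`), `P_C = (σC, λC)` (`c₄` at `c`, `c₀` elsewhere) with
`P_C` the latest. [this cell] -/
theorem concave_core_all (d : Fin K → ℕ) (v ε : Fin m → Fin m → Fin K → ℤ) (hm : 2 ≤ m)
    {c₀ c₁ c₂ c₃ c₄ : Fin K} (h01 : d c₀ < d c₁) (h12 : d c₁ < d c₂) (h23 : d c₂ < d c₃) (h04 : d c₀ ≤ d c₄)
    (hbudget : d c₃ + d c₀ ≤ 2 * d c₂)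
    {σA σB σC : Equiv.Perm (Fin m)} {lA lB lC : Fin m → Fin K} {b c : Fin m}
    (hlA : ∀ x, lA x = if x = b then c₁ else c₃) (hlB : ∀ x, lB x = c₂) (hlC : ∀ x, lC x = if x = c then c₄ else c₀)
    {θA θB θC : ℤ} (hA : IsDominant d v ε θA (σA, lA)) (hB : IsDominant d v ε θB (σB, lB)) (hC : IsDominant d v ε θC (σC, lC))
    (hAC : θA < θC) (hBC : θB < θC) : False := by
  -- a second column
  obtain ⟨x, hxb⟩ : ∃ x : Fin m, x ≠ b := by
    by_contra h
    push Not at h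
    have : Fintype.card (Fin m) ≤ 1 := Fintype.card_le_one_iff.mpr fun a a' => (h a).trans (h a').symm
    rw [Fintype.card_fin] at this
    omega
  refine core_law_transfer d v ε hm (fun z hz => by rw [hlC z, if_neg hz]) ?_ ?_ (fun z => by rw [hlB z]; exact h01.trans h12) ?_ ?_ ?_
    hxb ?_ hA hB hC hAC hBC (b := b) (x := x)
  · intro z; rw [hlC z]; split_ifs
    · exact h04
    · exact le_rfl
  · intro z; rw [hlA z]; split_ifs
    · exact h01
    · exact h01.trans (h12.trans h23)
  · intro z hz; rw [hlB z, hlA z, if_neg hz]; exact h23.le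
  · intro z hz; rw [hlA z, if_neg hz, hlB z, hlB b]; omega
  · rw [hlA b, if_pos rfl, hlB b]; exact h12
  · right; rw [hlA x, if_neg hxb, hlB x]; exact fun h => (ne_of_lt h23) (by rw [h])

/-- **CONCAVE CENSUS AT EVERY SIZE.**  `m ≥ 2`; classes with `d c₀ < d c₁ < d c₂ < d c₃`, budget `d c₃ + d c₀ ≤ 2·d c₂`, and a class `c₄` whose
one-off slope exceeds those of `c₁ c₃^{m−1}` and `c₂^m` (`d c₁ + (m−1)·d c₃ < (m−1)·d c₀ + d c₄`, `m·d c₂ < (m−1)·d c₀ + d c₄`).  Every chain of unique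
optima at strictly increasing slopes with consecutive terms distinct has `n + 2 ≤ multichoose K m`: it misses `c₁ c₃^{m−1}`, `c₂^m` or `c₀^{m−1} c₄`.
[this cell] -/
theorem concave_census_all (hm : 2 ≤ m) (d : Fin K → ℕ) (v ε : Fin m → Fin m → Fin K → ℤ) (c₀ c₁ c₂ c₃ c₄ : Fin K)
    (h01 : d c₀ < d c₁) (h12 : d c₁ < d c₂) (h23 : d c₂ < d c₃) (hbudget : d c₃ + d c₀ ≤ 2 * d c₂)
    (hAC : (d c₁ : ℤ) + (m - 1 : ℤ) * d c₃ < (m - 1 : ℤ) * d c₀ + d c₄) (hBC : (m : ℤ) * d c₂ < (m - 1 : ℤ) * d c₀ + d c₄)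
    {n : ℕ} (θ : Fin (n + 1) → ℤ) (p : Fin (n + 1) → Equiv.Perm (Fin m) × (Fin m → Fin K))
    (hθ : StrictMono θ) (hdom : ∀ k, IsDominant d v ε (θ k) (p k)) (hne : ∀ k : Fin n, p k.castSucc ≠ p k.succ) :
    n + 2 ≤ Nat.multichoose K m := by
  classical
  by_contra hlt
  have hn : Nat.multichoose K m ≤ n + 1 := by omega
  obtain ⟨hsm, hsurj⟩ := ParityLaw.classSym_surjective_of_full d v ε θ p hθ hdom hne hn
  -- the three pattern multisets
  have cardA : Multiset.card (c₁ ::ₘ Multiset.replicate (m - 1) c₃) = m := by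
    rw [Multiset.card_cons, Multiset.card_replicate]; omega
  have cardB : Multiset.card (Multiset.replicate m c₂) = m := Multiset.card_replicate _ _
  have cardC : Multiset.card (c₄ ::ₘ Multiset.replicate (m - 1) c₀) = m := by
    rw [Multiset.card_cons, Multiset.card_replicate]; omega
  obtain ⟨kA, hkA⟩ := hsurj ⟨c₁ ::ₘ Multiset.replicate (m - 1) c₃, cardA⟩
  obtain ⟨kB, hkB⟩ := hsurj ⟨Multiset.replicate m c₂, cardB⟩
  obtain ⟨kC, hkC⟩ := hsurj ⟨c₄ ::ₘ Multiset.replicate (m - 1) c₀, cardC⟩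
  have hkA' : (classSym (p kA) : Multiset (Fin K)) = c₁ ::ₘ Multiset.replicate (m - 1) c₃ := congrArg Subtype.val hkA
  have hkB' : (classSym (p kB) : Multiset (Fin K)) = Multiset.replicate m c₂ := congrArg Subtype.val hkB
  have hkC' : (classSym (p kC) : Multiset (Fin K)) = c₄ ::ₘ Multiset.replicate (m - 1) c₀ := congrArg Subtype.val hkC
  -- exponent facts
  have h01z : (d c₀ : ℤ) < d c₁ := by exact_mod_cast h01
  have h12z : (d c₁ : ℤ) < d c₂ := by exact_mod_cast h12
  have hm1 : (1 : ℤ) ≤ (m : ℤ) - 1 := by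
    have : (2 : ℤ) ≤ m := by exact_mod_cast hm
    linarith
  have h04 : d c₀ < d c₄ := by
    have hmul : ((m : ℤ) - 1) * d c₀ ≤ ((m : ℤ) - 1) * d c₂ := mul_le_mul_of_nonneg_left (h01z.trans h12z).le (by linarith)
    have : (d c₀ : ℤ) < d c₄ := by nlinarith
    exact_mod_cast this
  -- shapes
  obtain ⟨bs, hbs, hlA⟩ := ParityLaw.oneOff_of_classSym_cons (fun h => (ne_of_lt (h12.trans h23)) (by rw [h])) hkA'
  have hlB : ∀ x, (p kB).2 x = c₂ := ParityLaw.const_of_classSym_replicate hkB'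
  obtain ⟨cs, hcs, hlC⟩ := ParityLaw.oneOff_of_classSym_cons (fun h => (ne_of_lt h04) (by rw [h])) hkC'
  have hlA' : ∀ x, (p kA).2 x = if x = bs then c₁ else c₃ := by
    intro x
    by_cases hx : x = bs
    · rw [if_pos hx, hx, hbs]
    · rw [if_neg hx, hlA x hx]
  have hlC' : ∀ x, (p kC).2 x = if x = cs then c₄ else c₀ := by
    intro x
    by_cases hx : x = cs
    · rw [if_pos hx, hx, hcs]
    · rw [if_neg hx, hlC x hx]
  -- slopes of the three terms
  have slA : slope d (p kA) = (d c₁ : ℤ) + (m - 1 : ℤ) * d c₃ := by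
    rw [slope_eq_of_classSym, hkA', Multiset.map_cons, Multiset.sum_cons, Multiset.map_replicate, Multiset.sum_replicate,
      nsmul_eq_mul]
    push_cast [Nat.cast_sub (by omega : 1 ≤ m)]
    ring
  have slB : slope d (p kB) = (m : ℤ) * d c₂ := by
    rw [slope_eq_of_classSym, hkB', Multiset.map_replicate, Multiset.sum_replicate, nsmul_eq_mul]
  have slC : slope d (p kC) = (d c₄ : ℤ) + (m - 1 : ℤ) * d c₀ := by
    rw [slope_eq_of_classSym, hkC', Multiset.map_cons, Multiset.sum_cons, Multiset.map_replicate, Multiset.sum_replicate,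
      nsmul_eq_mul]
    push_cast [Nat.cast_sub (by omega : 1 ≤ m)]
    ring
  -- index order from slope order
  have hAC' : kA < kC := by
    have hs : slope d (p kA) < slope d (p kC) := by rw [slA, slC]; linarith
    exact hsm.lt_iff_lt.mp hs
  have hBC' : kB < kC := by
    have hs : slope d (p kB) < slope d (p kC) := by rw [slB, slC]; linarith
    exact hsm.lt_iff_lt.mp hs
  have hA : IsDominant d v ε (θ kA) ((p kA).1, (p kA).2) := hdom kA
  have hB : IsDominant d v ε (θ kB) ((p kB).1, (p kB).2) := hdom kB
  have hC : IsDominant d v ε (θ kC) ((p kC).1, (p kC).2) := hdom kC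
  exact concave_core_all d v ε hm h01 h12 h23 h04.le hbudget hlA' hlB hlC' hA hB hC (hθ hAC') (hθ hBC')

/-- **CONCAVE CENSUS AT EVERY SIZE, `DesignRowD` form.** [this cell] -/
theorem designRowD_concave_all (hm : 2 ≤ m) (d : Fin K → ℕ) (v ε : Fin m → Fin m → Fin K → ℤ) (c₀ c₁ c₂ c₃ c₄ : Fin K)
    (h01 : d c₀ < d c₁) (h12 : d c₁ < d c₂) (h23 : d c₂ < d c₃) (hbudget : d c₃ + d c₀ ≤ 2 * d c₂)
    (hAC : (d c₁ : ℤ) + (m - 1 : ℤ) * d c₃ < (m - 1 : ℤ) * d c₀ + d c₄) (hBC : (m : ℤ) * d c₂ < (m - 1 : ℤ) * d c₀ + d c₄) :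
    DesignRowD d v ε (Nat.multichoose K m - 2) := by
  intro n θ p hθ hdom hne
  have := concave_census_all hm d v ε c₀ c₁ c₂ c₃ c₄ h01 h12 h23 hbudget hAC hBC θ p hθ hdom hne
  omega

end Summit.ValiantsHypothesis.ValiantsHypothesis.Theorems.KPlusLogSqLaw.TopHeavyCore
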